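import Summits.FinalStateConjecture.FinalStateConjecture.Theorems.EIHFluxBalanceInertialRecessionChargeKinematicsRunPrep
import Summits.FinalStateConjecture.FinalStateConjecture.Theorems.EIHFluxBalanceInertialRecessionChargeKinematicsClusterAlgebra

/-!
# Route EIHFluxBalance — `InertialRecession`, line `old-light-leaves-the-cone`: charge kinematics, XXIX (general N: re-clustering, linear separation, level arithmetic)
Helper file for the crux `stmt-FinalStateConjecture-10166`, second line lead, endgame stub
`stub_expandingChargeKinematics` (S4) FOR GENERAL `N`. Re-clustering at a trigger (`recluster`), linear separation of frozen classes (`linear_separation_of_frozen`),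
and the level / key / budget arithmetic (`level_smallness`, `key_smallness`, `flyby_const_mono`, `budget_mono`).
Mathlib-only real analysis over the stub's verbatim hypotheses ([folklore]); the abstract charge `P` is adversarial.
-/
set_option linter.dupNamespace false

noncomputable section

open Filter Set Metric Real
open scoped Topology

namespace Summit.FinalStateConjecture.FinalStateConjecture.Theorems.ChargeKinematics

open Literature.Geometry.Lorentzian

/-! ## Ladder lemmas -/

section RunLadder

open MeasureTheory intervalIntegral

variable {N : ℕ} {M : Fin N → ℝ} {ξ v : Fin N → ℝ → E3} {κ : ℝ} {P : ℝ → E3 → ℝ → Fin 4 → ℝ}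

/-- **Re-clustering at a trigger.** Given labels `cl` on `A` whose different classes are `≥ θ_s ρ^K` apart
(in `w`), and a same-class pair at distance `≥ θ_s ρ^K`, the gap clustering of `exists_gap_scale` one
ladder down yields labels `cl'` with intra `< θ_s ρ^j`, inter `≥ θ_s ρ^{j+1}` (`j < K`) and strictly
more classes. [folklore] -/
theorem recluster {N : ℕ} (A : Finset (Fin N)) (w : Fin N → E3) (cl : Fin N → ℕ) {θs ρ : ℝ}
    (hθs : 0 < θs) (hρ : 2 ≤ ρ) {K : ℕ} (hK : A.card ^ 2 < K)
    (hinter : ∀ i ∈ A, ∀ i' ∈ A, cl i ≠ cl i' → θs * ρ ^ K ≤ ‖w i - w i'‖)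
    {i₀ j₀ : Fin N} (hi₀ : i₀ ∈ A) (hj₀ : j₀ ∈ A) (hcl₀ : cl i₀ = cl j₀)
    (hfar₀ : θs * ρ ^ K ≤ ‖w i₀ - w j₀‖) :
    ∃ (cl' : Fin N → ℕ) (j : Fin K),
      (∀ i ∈ A, ∀ i' ∈ A, cl' i = cl' i' → ‖w i - w i'‖ < θs * ρ ^ (j : ℕ)) ∧
      (∀ i ∈ A, ∀ i' ∈ A, cl' i ≠ cl' i' → θs * ρ ^ ((j : ℕ) + 1) ≤ ‖w i - w i'‖) ∧
      (A.image cl).card + 1 ≤ (A.image cl').card := by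
  classical
  obtain ⟨j, hdich, htrans⟩ := exists_gap_scale A w hθs hρ hK
  set t : ℝ := θs * ρ ^ (j : ℕ) with htdef
  have hρ1 : (1 : ℝ) ≤ ρ := by linarith
  -- the ladder value is below the old inter-class bound
  have htK : θs * ρ ^ ((j : ℕ) + 1) ≤ θs * ρ ^ K :=
    mul_le_mul_of_nonneg_left (pow_le_pow_right₀ hρ1 j.2) hθs.le
  have htt : t ≤ θs * ρ ^ ((j : ℕ) + 1) := by
    simp only [htdef]
    exact mul_le_mul_of_nonneg_left (pow_le_pow_right₀ hρ1 (Nat.le_succ _)) hθs.le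
  -- the relation and its classes
  have hrefl : ∀ i, ‖w i - w i‖ < t := fun i ↦ by simp only [sub_self, norm_zero, htdef]; positivity
  have hsymm : ∀ i i', ‖w i - w i'‖ < t → ‖w i' - w i‖ < t := fun i i' h ↦ by rwa [norm_sub_rev]
  have hne : ∀ i ∈ A, (A.filter fun i' ↦ ‖w i - w i'‖ < t).Nonempty := fun i hi ↦
    ⟨i, Finset.mem_filter.mpr ⟨hi, hrefl i⟩⟩
  obtain ⟨cl', hcl'⟩ : ∃ f : Fin N → ℕ, ∀ i (hi : i ∈ A),
      f i = ((A.filter fun i' ↦ ‖w i - w i'‖ < t).min' (hne i hi) : ℕ) := by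
    refine ⟨fun i ↦ if hi : i ∈ A then ((A.filter fun i' ↦ ‖w i - w i'‖ < t).min' (hne i hi) : ℕ) else 0,
      fun i hi ↦ by simp [hi]⟩
  -- `cl' i = cl' i'` iff related
  have hclass_eq : ∀ i ∈ A, ∀ i' ∈ A, ‖w i - w i'‖ < t →
      (A.filter fun l ↦ ‖w i - w l‖ < t) = (A.filter fun l ↦ ‖w i' - w l‖ < t) := by
    intro i hi i' hi' h
    ext l
    simp only [Finset.mem_filter, and_congr_right_iff]
    intro hl
    exact ⟨fun h' ↦ htrans i' hi' i hi l hl (hsymm i i' h) h', fun h' ↦ htrans i hi i' hi' l hl h h'⟩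
  have hiff : ∀ i ∈ A, ∀ i' ∈ A, (cl' i = cl' i' ↔ ‖w i - w i'‖ < t) := by
    intro i hi i' hi'
    constructor
    · intro h
      rw [hcl' i hi, hcl' i' hi'] at h
      have h' := Fin.ext h
      -- the common minimum is related to both
      have hm1 : (A.filter fun l ↦ ‖w i - w l‖ < t).min' (hne i hi) ∈ A.filter fun l ↦ ‖w i - w l‖ < t :=
        Finset.min'_mem _ _
      have hm2 : (A.filter fun l ↦ ‖w i - w l‖ < t).min' (hne i hi) ∈ A.filter fun l ↦ ‖w i' - w l‖ < t := by
        rw [h']; exact Finset.min'_mem _ _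
      obtain ⟨hmA, hm1'⟩ := Finset.mem_filter.mp hm1
      obtain ⟨-, hm2'⟩ := Finset.mem_filter.mp hm2
      exact htrans i hi _ hmA i' hi' hm1' (hsymm i' _ hm2')
    · intro h
      simp only [hcl' i hi, hcl' i' hi', hclass_eq i hi i' hi' h]
  refine ⟨cl', j, fun i hi i' hi' h ↦ (hiff i hi i' hi').mp h, fun i hi i' hi' h ↦ ?_, ?_⟩
  · rcases hdich i hi i' hi' with h' | h'
    · exact absurd ((hiff i hi i' hi').mpr h') h
    · exact h'
  · -- `cl` factors through `cl'` and the trigger pair separates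
    have hrefine : ∀ i ∈ A, ∀ i' ∈ A, cl' i = cl' i' → cl i = cl i' := by
      intro i hi i' hi' h
      by_contra hne'
      have h1 := hinter i hi i' hi' hne'
      have h2 := (hiff i hi i' hi').mp h
      linarith [htt.trans htK]
    -- a section `rep` of `cl'` on `A.image cl'`
    have hrep : ∀ c ∈ A.image cl', ∃ i ∈ A, cl' i = c := fun c hc ↦ by
      simpa [Finset.mem_image] using hc
    haveI : Nonempty (Fin N) := ⟨i₀⟩
    choose! rep hrepA hrepcl using hrep
    have himage : A.image cl = (A.image cl').image (fun c ↦ cl (rep c)) := by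
      ext x
      simp only [Finset.mem_image]
      constructor
      · rintro ⟨i, hi, rfl⟩
        refine ⟨cl' i, ⟨i, hi, rfl⟩, ?_⟩
        have hc : cl' i ∈ A.image cl' := Finset.mem_image_of_mem _ hi
        exact hrefine _ (hrepA _ hc) i hi (hrepcl _ hc)
      · rintro ⟨c, ⟨i, hi, rfl⟩, rfl⟩
        have hc : cl' i ∈ A.image cl' := Finset.mem_image_of_mem _ hi
        exact ⟨rep (cl' i), hrepA _ hc, rfl⟩
    have hnotinj : ¬ Set.InjOn (fun c ↦ cl (rep c)) (A.image cl' : Set ℕ) := by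
      intro hinj
      have hc₁ : cl' i₀ ∈ A.image cl' := Finset.mem_image_of_mem _ hi₀
      have hc₂ : cl' j₀ ∈ A.image cl' := Finset.mem_image_of_mem _ hj₀
      have heq : cl (rep (cl' i₀)) = cl (rep (cl' j₀)) := by
        rw [hrefine _ (hrepA _ hc₁) i₀ hi₀ (hrepcl _ hc₁), hrefine _ (hrepA _ hc₂) j₀ hj₀ (hrepcl _ hc₂)]
        exact hcl₀
      have hsame : cl' i₀ = cl' j₀ := hinj hc₁ hc₂ heq
      have hlt := (hiff i₀ hi₀ j₀ hj₀).mp hsame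
      linarith [htt.trans htK]
    have hle : ((A.image cl').image (fun c ↦ cl (rep c))).card ≤ (A.image cl').card := Finset.card_image_le
    have hne' : ((A.image cl').image (fun c ↦ cl (rep c))).card ≠ (A.image cl').card := fun h ↦
      hnotinj (Finset.card_image_iff.mp h)
    rw [himage]
    omega

/-- **Frozen classes separate linearly.** If from `t₁` on every velocity stays within `ρT₁/16` of its value
at `t₁`, the slaving defect is `≤ T₁/2`, and two holes had relative velocity `≥ ρT₁` at `t₁` (`ρ ≥ 16`),
then eventually `‖ξ_i(s) − ξ_j(s)‖ ≥ (ρT₁/4)·s`. [folklore] -/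
theorem linear_separation_of_frozen (hd : ∀ i, Differentiable ℝ (ξ i)) {t₁ T₁ ρ : ℝ} (hρ : 16 ≤ ρ)
    (hT₁ : 0 < T₁) (hσ : ∀ i s, t₁ ≤ s → ‖deriv (ξ i) s - v i s‖ ≤ T₁ / 2) {i j : Fin N}
    (hbig : ρ * T₁ ≤ ‖v j t₁ - v i t₁‖)
    (hfi : ∀ s, t₁ ≤ s → ‖v i s - v i t₁‖ ≤ ρ * T₁ / 16) (hfj : ∀ s, t₁ ≤ s → ‖v j s - v j t₁‖ ≤ ρ * T₁ / 16) :
    ∀ᶠ s in atTop, ρ * T₁ / 4 * s ≤ ‖ξ i s - ξ j s‖ := by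
  have hρT : 0 < ρ * T₁ := by positivity
  have hne : v j t₁ - v i t₁ ≠ 0 := by
    intro h0; rw [h0, norm_zero] at hbig; linarith
  obtain ⟨hu1, hur⟩ := unit_smul_facts hne
  set u : E3 := ‖v j t₁ - v i t₁‖⁻¹ • (v j t₁ - v i t₁) with hudef
  -- the certified coordinate and its rate
  have hφd : ∀ s, HasDerivAt (fun s ↦ @inner ℝ E3 _ u (ξ j s - ξ i s))
      (@inner ℝ E3 _ u (deriv (ξ j) s - deriv (ξ i) s)) s := fun s ↦ hasDerivAt_inner_sub (hd j) (hd i) u s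
  have hrate : ∀ s, t₁ ≤ s → ρ * T₁ / 2 ≤ @inner ℝ E3 _ u (deriv (ξ j) s - deriv (ξ i) s) := by
    intro s hs
    have key := certify_rate (db := deriv (ξ j) s) (dx := deriv (ξ i) s) hu1 hur hbig (hfj s hs) (hfi s hs)
      (hσ j s hs) (hσ i s hs)
    nlinarith
  -- growth by the mean value theorem
  have hgrow : ∀ s, t₁ ≤ s → @inner ℝ E3 _ u (ξ j t₁ - ξ i t₁) + ρ * T₁ / 2 * (s - t₁) ≤
      @inner ℝ E3 _ u (ξ j s - ξ i s) := by
    intro s hs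
    have hcont : ContinuousOn (fun s ↦ @inner ℝ E3 _ u (ξ j s - ξ i s)) (Set.Icc t₁ s) :=
      fun x _ ↦ (hφd x).continuousAt.continuousWithinAt
    have hdiff : DifferentiableOn ℝ (fun s ↦ @inner ℝ E3 _ u (ξ j s - ξ i s)) (interior (Set.Icc t₁ s)) :=
      fun x _ ↦ (hφd x).differentiableAt.differentiableWithinAt
    have hge : ∀ x ∈ interior (Set.Icc t₁ s),
        ρ * T₁ / 2 ≤ deriv (fun s ↦ @inner ℝ E3 _ u (ξ j s - ξ i s)) x := by
      intro x hx
      rw [interior_Icc] at hx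
      rw [(hφd x).deriv]
      exact hrate x hx.1.le
    have := (convex_Icc t₁ s).mul_sub_le_image_sub_of_le_deriv hcont hdiff hge
      t₁ ⟨le_rfl, hs⟩ s ⟨hs, le_rfl⟩ hs
    linarith
  -- the initial value is at least `-d₁`
  have hinit : -‖ξ j t₁ - ξ i t₁‖ ≤ @inner ℝ E3 _ u (ξ j t₁ - ξ i t₁) := by
    have := abs_inner_le_norm_of_unit (w := ξ j t₁ - ξ i t₁) hu1
    rw [abs_le] at this; exact this.1
  refine eventually_atTop.mpr ⟨max t₁ (2 * t₁ + 4 * ‖ξ j t₁ - ξ i t₁‖ / (ρ * T₁)), fun s hs ↦ ?_⟩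
  have hs1 : t₁ ≤ s := (le_max_left _ _).trans hs
  have hs2 : 2 * t₁ + 4 * ‖ξ j t₁ - ξ i t₁‖ / (ρ * T₁) ≤ s := (le_max_right _ _).trans hs
  have hCS : @inner ℝ E3 _ u (ξ j s - ξ i s) ≤ ‖ξ i s - ξ j s‖ := by
    have := abs_inner_le_norm_of_unit (w := ξ j s - ξ i s) hu1
    rw [abs_le, norm_sub_rev] at this; exact this.2
  have h1 := hgrow s hs1
  -- `(ρT₁/2)(s - t₁) - d₁ ≥ (ρT₁/4)s`
  have h2 : ρ * T₁ / 4 * s ≤ ρ * T₁ / 2 * (s - t₁) - ‖ξ j t₁ - ξ i t₁‖ := by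
    have h3 : 4 * ‖ξ j t₁ - ξ i t₁‖ / (ρ * T₁) * (ρ * T₁) = 4 * ‖ξ j t₁ - ξ i t₁‖ := by
      field_simp
    have h4 : (2 * t₁ + 4 * ‖ξ j t₁ - ξ i t₁‖ / (ρ * T₁)) * (ρ * T₁) ≤ s * (ρ * T₁) :=
      mul_le_mul_of_nonneg_right hs2 hρT.le
    rw [add_mul, h3] at h4
    nlinarith
  linarith

/-- Level smallness (pure arithmetic): from the budget bound at the base tail to the RUN-step smallness
at a later tail. [folklore] -/
theorem level_smallness {PN Cw N1 F tl₀ tl₁ ε Ma ρ T : ℝ} (hPN : 1 ≤ PN) (hCw : 0 ≤ Cw) (hN1 : 0 ≤ N1)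
    (hMa : 0 < Ma) (htl : tl₀ ≤ tl₁) (hρ : 128 * PN ≤ ρ) (hT : 0 ≤ T)
    (hb : PN * (4 * (Cw * (N1 * (F + tl₁)) + 3 * ε) / Ma) < ρ * T / 32) :
    PN * (4 * (Cw * (N1 * (F + tl₀)) + 3 * ε) / Ma + 2 * (2 * T)) < ρ * T / 16 := by
  have h1 : Cw * (N1 * (F + tl₀)) ≤ Cw * (N1 * (F + tl₁)) :=
    mul_le_mul_of_nonneg_left (mul_le_mul_of_nonneg_left (by linarith) hN1) hCw
  have h2 : 4 * (Cw * (N1 * (F + tl₀)) + 3 * ε) / Ma ≤ 4 * (Cw * (N1 * (F + tl₁)) + 3 * ε) / Ma :=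
    div_le_div_of_nonneg_right (by linarith) hMa.le
  have h3 : PN * (4 * (Cw * (N1 * (F + tl₀)) + 3 * ε) / Ma) ≤ PN * (4 * (Cw * (N1 * (F + tl₁)) + 3 * ε) / Ma) :=
    mul_le_mul_of_nonneg_left h2 (by linarith)
  have h4 : PN * (2 * (2 * T)) ≤ ρ * T / 32 := by
    have := mul_le_mul_of_nonneg_right hρ hT
    nlinarith
  rw [mul_add]
  linarith

/-- Key smallness from three quarter-bounds (pure arithmetic). [folklore] -/
theorem key_smallness {PN Cw N1 F τt ε Mmin X : ℝ} (hX : 0 < X)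
    (hF : PN * (4 * (Cw * (N1 * F))) / Mmin < X / 4) (hτ : PN * (4 * (Cw * (N1 * τt))) / Mmin ≤ X / 4)
    (hε : PN * (4 * (3 * ε)) / Mmin ≤ X / 4) :
    PN * (4 * (Cw * (N1 * (F + τt)) + 3 * ε) / Mmin) < X := by
  have : PN * (4 * (Cw * (N1 * (F + τt)) + 3 * ε) / Mmin) =
      (PN * (4 * (Cw * (N1 * F))) + PN * (4 * (Cw * (N1 * τt))) + PN * (4 * (3 * ε))) / Mmin := by
    ring
  rw [this, add_div, add_div]
  linarith

/-- Monotonicity of the fly-by constant in the rate. [folklore] -/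
theorem flyby_const_mono {B c g₁ g₂ : ℝ} (hB : 0 < B) (hc : 0 < c) (hg₁ : 0 < g₁) (hg : g₁ ≤ g₂) :
    9 * (2 * 2 * B ^ (1 - 2 : ℝ) / ((2 - 1) * (3 * g₂ / c))) +
      (3 : ℝ) ^ (7 / 4 : ℝ) * (2 * (7 / 4) * B ^ (1 - 7 / 4 : ℝ) / ((7 / 4 - 1) * (3 * g₂ / c))) ≤
    9 * (2 * 2 * B ^ (1 - 2 : ℝ) / ((2 - 1) * (3 * g₁ / c))) +
      (3 : ℝ) ^ (7 / 4 : ℝ) * (2 * (7 / 4) * B ^ (1 - 7 / 4 : ℝ) / ((7 / 4 - 1) * (3 * g₁ / c))) := by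
  have h1 : (2 - 1) * (3 * g₁ / c) ≤ (2 - 1) * (3 * g₂ / c) := by
    apply mul_le_mul_of_nonneg_left _ (by norm_num)
    exact div_le_div_of_nonneg_right (by linarith) hc.le
  have h2 : (7 / 4 - 1) * (3 * g₁ / c) ≤ (7 / 4 - 1) * (3 * g₂ / c) := by
    apply mul_le_mul_of_nonneg_left _ (by norm_num)
    exact div_le_div_of_nonneg_right (by linarith) hc.le
  have hp1 : 0 < (2 - 1) * (3 * g₁ / c) := by positivity
  have hp2 : 0 < (7 / 4 - 1) * (3 * g₁ / c) := by norm_num; positivity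
  refine add_le_add ?_ ?_
  · refine mul_le_mul_of_nonneg_left ?_ (by norm_num)
    exact div_le_div_of_nonneg_left (by positivity) hp1 h1
  · refine mul_le_mul_of_nonneg_left ?_ (by positivity)
    exact div_le_div_of_nonneg_left (by positivity) hp2 h2

/-- Monotonicity of the level budget in its data (pure arithmetic). [folklore] -/
theorem budget_mono {PN Cw N1 F₁ F₂ tl τt ε Ma Mmin : ℝ} (hPN : 0 ≤ PN) (hCw : 0 ≤ Cw) (hN1 : 0 ≤ N1)
    (hε : 0 ≤ ε) (hF : F₁ ≤ F₂) (hF₁ : 0 ≤ F₁) (htl : tl ≤ τt) (htl0 : 0 ≤ tl) (hMmin : 0 < Mmin)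
    (hMa : Mmin ≤ Ma) :
    PN * (4 * (Cw * (N1 * (F₁ + tl)) + 3 * ε) / Ma) ≤ PN * (4 * (Cw * (N1 * (F₂ + τt)) + 3 * ε) / Mmin) := by
  refine mul_le_mul_of_nonneg_left ?_ hPN
  have hnum : 0 ≤ 4 * (Cw * (N1 * (F₁ + tl)) + 3 * ε) := by positivity
  calc 4 * (Cw * (N1 * (F₁ + tl)) + 3 * ε) / Ma ≤ 4 * (Cw * (N1 * (F₁ + tl)) + 3 * ε) / Mmin :=
        div_le_div_of_nonneg_left hnum hMmin hMa
    _ ≤ 4 * (Cw * (N1 * (F₂ + τt)) + 3 * ε) / Mmin := by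
        refine div_le_div_of_nonneg_right ?_ hMmin.le
        have : Cw * (N1 * (F₁ + tl)) ≤ Cw * (N1 * (F₂ + τt)) :=
          mul_le_mul_of_nonneg_left (mul_le_mul_of_nonneg_left (by linarith) hN1) hCw
        linarith

end RunLadder

end Summit.FinalStateConjecture.FinalStateConjecture.Theorems.ChargeKinematics

namespace Summit.FinalStateConjecture.FinalStateConjecture.Theorems

/-- REGISTERED STUB `recluster` of the crux item stmt-FinalStateConjecture-10166 (second line lead, line
`old-light-leaves-the-cone`, S4): the registered signature verbatim, by `ChargeKinematics.recluster`. [folklore] -/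
theorem recluster : open Literature.Geometry.Lorentzian Filter Topology MeasureTheory intervalIntegral in ∀ {N : ℕ} (A : Finset (Fin N)) (w : Fin N → E3) (cl : Fin N → ℕ) {θs ρ : ℝ} (hθs : 0 < θs) (hρ : 2 ≤ ρ) {K : ℕ} (hK : A.card ^ 2 < K) (hinter : ∀ i ∈ A, ∀ i' ∈ A, cl i ≠ cl i' → θs * ρ ^ K ≤ ‖w i - w i'‖) {i₀ j₀ : Fin N} (hi₀ : i₀ ∈ A) (hj₀ : j₀ ∈ A) (hcl₀ : cl i₀ = cl j₀) (hfar₀ : θs * ρ ^ K ≤ ‖w i₀ - w j₀‖), ∃ (cl' : Fin N → ℕ) (j : Fin K), (∀ i ∈ A, ∀ i' ∈ A, cl' i = cl' i' → ‖w i - w i'‖ < θs * ρ ^ (j : ℕ)) ∧ (∀ i ∈ A, ∀ i' ∈ A, cl' i ≠ cl' i' → θs * ρ ^ ((j : ℕ) + 1) ≤ ‖w i - w i'‖) ∧ (A.image cl).card + 1 ≤ (A.image cl').card :=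
  @ChargeKinematics.recluster

end Summit.FinalStateConjecture.FinalStateConjecture.Theorems

end
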